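import Literature.MathematicalPhysics.QuantumLattice.InfVolFermionStateTorusLimitSpinSectorGibbsRows
import Literature.MathematicalPhysics.QuantumLattice.InfVolFermionStateTorusLimitTwoSectorCompanion
import Literature.MathematicalPhysics.QuantumLattice.TorusSectorGibbsMixtureChargeRows
import HarnessLib

/-!
# Spin densities of torus limits of general joint-sector mixtures `(N_L, S^z = M_L)`: the density rows
# of the COMPANION states of the two-sector rows

Topic `Literature/MathematicalPhysics/QuantumLattice`; complement of `HubbardSquareTorusLimitState.lean` /
`TorusSectorGibbsMixtureChargeRows.lean` (the spin densities `ω(n_{0σ}) = ρ/2` of torus limits of `S^z = 0`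
families) and of `InfVolFermionStateTorusLimitSpinSectorGibbsRows.lean` (eom + gauge-invariant EEB rows of
torus limits of the canonical states of a general spin sector). The companion state `ω'` of the two-sector
(charged) rows is a torus limit of canonical Gibbs eigen-mixtures of spin sectors `(a_L, b_L)` with
`a_L ≠ b_L` in general (e.g. `(k_L − 1, k_L)` for the template `c_{x↑}`); its density rows are

  `ω'(n_{0↑}) = lim_j a_{L_j}/L_j²`,  `ω'(n_{0↓}) = lim_j b_{L_j}/L_j²`

(both `= n/2` for the single-particle and pair companions of the object of record at filling `n`):

* `spinNumber_mulVec_of_mem_szSector'` — on the joint sector `(N, S^z = M)` the spin-`σ` number acts as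
  `N/2 ± M`; `torusAvgExpect_nAt_of_mem_szSector'` — the translation average of `n_{0σ}` in a unit vector
  of that sector is `(N/2 ± M)/L^d` (any `d`);
* `IsTorusLimitOfMixture.expect_nAt_eq_of_szSector'` — for a torus limit of mixtures of unit vectors of
  the sectors `(N_L, M_L)` with weights summing to `1` (eventually) and `(N_{L_j}/2 ± M_{L_j})/L_j^d → ρ_σ`:
  `ω(n_{0σ}) = ρ_σ`;
* `IsTorusLimitOfMixture.re_expect_nAt_eq_of_spinSectorGibbs` — by name for the canonical eigen-mixtures of
  the spin sectors `(a_L, b_L)` of `hubbardTorusTT'` (sectors eventually nonempty):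
  `Re ω(n_{0↑}) = lim a_L/L²`, `Re ω(n_{0↓}) = lim b_L/L²`.

Everything is PROVED; no definition, no named fact.

## Mathlib / tree search

REUSED: `sum_numberOp_eq_half_totalNumber_add_spinZ`, `totalNumber_mulVec_of_isNParticle`, `mem_szSector_iff`
(`HubbardTorusLocalCertificate`, …), `injOn_proj_singleton`, `sum_expect_numberOp_fockTranslate`
(`InfVolFermionStateDensity`), `fermionEmbed_numberOp`, `PolySite.toTorusEmb_apply`, `torusAvgExpect_eq`,
`torusAvgExpectAt_of_injOn`, `mem_szSector_iff_spinConfig`, `sum_canonicalWeight`,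
`star_sectorEigenvector_dotProduct_self`, `exists_spinConfig_of_le` (`…TwoSectorCompanion`); membership of
the eigenvectors via `mem_szSector_iff_spinConfig` + the support of `sectorEigenvector`.
`lean search 'nAt.*szSector'`: only the `S^z = 0` versions (2026-08-27).

## References

* E. H. Lieb, Phys. Rev. Lett. 62 (1989) 1201, eq. (2) (`N_σ` on spin sectors). [cite: LiebPRL1989, eq. (2)]
* D. Ruelle, *Statistical Mechanics: Rigorous Results* (1969), §3.4 (densities of infinite-volume limit
  states). [cite: Ruelle1969, §3.4]
-/

noncomputable section

namespace Literature.MathematicalPhysics.QuantumLattice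

open Matrix Finset HubbardWave0 Literature.Probability.LatticeModels ThermodynamicLimit
open _root_.Filter
open scoped _root_.Topology ComplexOrder BigOperators

/-! ### §1 Finite volume: the spin-`σ` number on a joint sector `(N, S^z = M)` -/

section Finite

variable {d : ℕ}

/-- **On the joint sector `(N, S^z = M)` the spin-`σ` number acts as `N/2 ± M`**:
`(Σ_y n_{y↑}) ψ = (N/2 + M) ψ`, `(Σ_y n_{y↓}) ψ = (N/2 − M) ψ`. [cite: LiebPRL1989, eq. (2)] -/
theorem spinNumber_mulVec_of_mem_szSector' {Λ : Type*} [LinearOrder Λ] [Fintype Λ] (σ : Fin 2)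
    {N : ℕ} {M : ℝ} {ψ : Fock (Orb Λ)} (hψ : ψ ∈ szSector N M) :
    (∑ y : Λ, numberOp y σ) *ᵥ ψ =
      ((((N : ℝ) / 2 + (if σ = 0 then M else -M) : ℝ)) : ℂ) • ψ := by
  obtain ⟨hN, hS⟩ := (mem_szSector_iff N M ψ).1 hψ
  rw [sum_numberOp_eq_half_totalNumber_add_spinZ, Matrix.add_mulVec, Matrix.smul_mulVec,
    Matrix.smul_mulVec, totalNumber_mulVec_of_isNParticle hN, hS, smul_smul, smul_smul, ← add_smul]
  congr 1
  split_ifs with h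
  · push_cast; ring
  · push_cast; ring

/-- **Translation-averaged spin density in a joint-sector unit vector**: for `ψ ∈ (N, S^z = M)` of the
`d`-torus of side `L` with `‖ψ‖ = 1`, the translation average of `n_{0σ}` is `(N/2 ± M)/L^d`.
[cite: LiebPRL1989, eq. (2)] -/
theorem torusAvgExpect_nAt_of_mem_szSector' (L : ℕ) [NeZero L] (σ : Fin 2) {N : ℕ} {M : ℝ}
    {ψ : Fock (Orb (FermionTorus d L))} (hψS : ψ ∈ szSector N M) (hψ : star ψ ⬝ᵥ ψ = 1) :
    torusAvgExpect L ({0} : Finset (Site d)) (nAt 0 (Finset.mem_singleton_self 0) σ) ψ =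
      ((((N : ℝ) / 2 + (if σ = 0 then M else -M) : ℝ)) : ℂ) / ((L : ℂ) ^ d) := by
  have h := injOn_proj_singleton (d := d) L 0
  have hcard : Fintype.card (TorusSite d L) = L ^ d := by simp [ZMod.card, Fintype.card_fin]
  have hproj : Torus.proj L (0 : Site d) = 0 := by funext i; simp [Torus.proj]
  rw [torusAvgExpect_eq, torusAvgExpectAt_of_injOn L h, hcard, Nat.cast_pow, div_eq_inv_mul]
  congr 1
  have hn : fermionEmbed (PolySite.toTorusEmb L h) (nAt 0 (Finset.mem_singleton_self 0) σ) =
      numberOp (FermionTorus.ofTorusSite (0 : TorusSite d L)) σ := by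
    rw [nAt, fermionEmbed_numberOp, PolySite.toTorusEmb_apply, PolySite.ofLex_coe_pt, hproj]
  rw [hn, sum_expect_numberOp_fockTranslate, expect, spinNumber_mulVec_of_mem_szSector' σ hψS,
    dotProduct_smul, hψ, smul_eq_mul, mul_one]

end Finite

/-! ### §2 Torus limits -/

namespace InfVolFermionState

variable {d : ℕ}

/-- **Spin densities of a torus limit of joint-sector mixtures.** Let `ω` be a torus limit along
`Ls → ∞` of mixtures `(p_{L,i}, ψ_{L,i})` whose components are unit vectors of the joint sectors
`(N_L, S^z = M_L)` and whose weights sum to `1` eventually along `Ls`. If `(N_{L_j}/2 ± M_{L_j})/L_j^d → ρ_σ`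
then `ω(n_{0σ}) = ρ_σ`. [cite: Ruelle1969, §3.4] [cite: LiebPRL1989, eq. (2)] -/
theorem IsTorusLimitOfMixture.expect_nAt_eq_of_szSector' {ω : InfVolFermionState d} {m : ℕ → ℕ}
    {p : ∀ L, Fin (m L) → ℝ} {ψ : ∀ L, Fin (m L) → Fock (Orb (FermionTorus d L))} {Ls : ℕ → ℕ}
    (h : ω.IsTorusLimitOfMixture m p ψ Ls) (hLs : Tendsto Ls atTop atTop) {N : ℕ → ℕ} {M : ℕ → ℝ}
    (hS : ∀ L i, ψ L i ∈ szSector (N L) (M L)) (h1 : ∀ L i, star (ψ L i) ⬝ᵥ ψ L i = 1)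
    (hp1 : ∀ᶠ j in atTop, ∑ i, p (Ls j) i = 1) (σ : Fin 2) {ρσ : ℝ}
    (hρ : Tendsto (fun j => ((N (Ls j) : ℝ) / 2 + (if σ = 0 then M (Ls j) else -M (Ls j))) / (Ls j : ℝ) ^ d)
      atTop (𝓝 ρσ)) :
    ω.expect {0} (nAt 0 (Finset.mem_singleton_self 0) σ) = ((ρσ : ℝ) : ℂ) := by
  have hlim := h ({0} : Finset (Site d)) (nAt 0 (Finset.mem_singleton_self 0) σ)
  have hρ' : Tendsto (fun j => (((((N (Ls j) : ℝ) / 2 + (if σ = 0 then M (Ls j) else -M (Ls j))) /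
      (Ls j : ℝ) ^ d : ℝ)) : ℂ)) atTop (𝓝 ((ρσ : ℝ) : ℂ)) :=
    (Complex.continuous_ofReal.tendsto _).comp hρ
  refine tendsto_nhds_unique hlim (hρ'.congr' ?_)
  filter_upwards [hLs.eventually_ge_atTop 1, hp1] with j hj hpj
  haveI : NeZero (Ls j) := ⟨by omega⟩
  have hterm : ∀ i, torusAvgExpect (Ls j) ({0} : Finset (Site d)) (nAt 0 (Finset.mem_singleton_self 0) σ)
      (ψ (Ls j) i) = ((((N (Ls j) : ℝ) / 2 + (if σ = 0 then M (Ls j) else -M (Ls j)) : ℝ)) : ℂ) /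
        ((Ls j : ℂ) ^ d) := fun i =>
    torusAvgExpect_nAt_of_mem_szSector' (Ls j) σ (hS _ i) (h1 _ i)
  simp_rw [hterm, ← Finset.sum_mul]
  rw [show (∑ i, (p (Ls j) i : ℂ)) = ((∑ i, p (Ls j) i : ℝ) : ℂ) by push_cast; rfl, hpj]
  push_cast
  ring

/-- **Density rows of torus limits of spin-sector canonical Gibbs states, by name.** Let `ω` be a torus
limit along `Ls → ∞` of the canonical Gibbs eigen-mixtures (weights `canonicalWeight`, vectors
`sectorEigenvector`, any enumerations) of `hubbardTorusTT' L t t' U` on the spin sectors `(a_L, b_L)`,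
nonempty eventually along `Ls` (`a_L, b_L ≤ L²`). If `a_{L_j}/L_j² → ρ↑` then `Re ω(n_{0↑}) = ρ↑`, and if
`b_{L_j}/L_j² → ρ↓` then `Re ω(n_{0↓}) = ρ↓` — the density rows of the companion states of the two-sector
energy–entropy balance rows (for the companions `(k_L ∓ 1, k_L)`, `(k_L − 1, k_L − 1)` of the object of
record at filling `n`, both limits are `n/2`). [cite: Ruelle1969, §3.4] [cite: LiebPRL1989, eq. (2)] -/
theorem IsTorusLimitOfMixture.re_expect_nAt_eq_of_spinSectorGibbs (t t' U β : ℝ) (a b : ℕ → ℕ)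
    {m : ℕ → ℕ} {p : ∀ L, Fin (m L) → ℝ} {ψ : ∀ L, Fin (m L) → Fock (Orb (FermionTorus 2 L))}
    (e : ∀ L, Fin (m L) ≃ Subtype (spinConfig (Λ := FermionTorus 2 L) (a L) (b L)))
    (hp : ∀ L i, p L i = canonicalWeight β (sectorEigenvalue (spinConfig (a L) (b L)) (hubbardTorusTT' L t t' U)
      (hubbardTorusTT'_isHermitian L t t' U)) (e L i))
    (hψ : ∀ L i, ψ L i = sectorEigenvector (spinConfig (a L) (b L)) (hubbardTorusTT' L t t' U)
      (hubbardTorusTT'_isHermitian L t t' U) (e L i))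
    {Ls : ℕ → ℕ} (hLs : Tendsto Ls atTop atTop) {ω : InfVolFermionState 2}
    (hω : ω.IsTorusLimitOfMixture m p ψ Ls)
    (hab : ∀ᶠ j in atTop, a (Ls j) ≤ Ls j * Ls j ∧ b (Ls j) ≤ Ls j * Ls j) :
    (∀ {ρ : ℝ}, Tendsto (fun j => (a (Ls j) : ℝ) / (Ls j : ℝ) ^ 2) atTop (𝓝 ρ) →
        (ω.expect {0} (nAt 0 (Finset.mem_singleton_self 0) 0)).re = ρ) ∧
      (∀ {ρ : ℝ}, Tendsto (fun j => (b (Ls j) : ℝ) / (Ls j : ℝ) ^ 2) atTop (𝓝 ρ) →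
        (ω.expect {0} (nAt 0 (Finset.mem_singleton_self 0) 1)).re = ρ) := by
  -- the components are unit vectors of the joint sectors `(a + b, (a − b)/2)`
  have hS : ∀ L i, ψ L i ∈ szSector (a L + b L) ((((a L : ℝ)) - b L) / 2) := by
    intro L i
    rw [hψ L i, mem_szSector_iff_spinConfig]
    intro s hs
    simp [sectorEigenvector, sectorExtend, hs]
  have h1 : ∀ L i, star (ψ L i) ⬝ᵥ ψ L i = 1 := by
    intro L i
    rw [hψ L i]
    exact star_sectorEigenvector_dotProduct_self _ _ _ _
  have hp1 : ∀ᶠ j in atTop, ∑ i, p (Ls j) i = 1 := by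
    filter_upwards [hab] with j hj
    obtain ⟨s, hs⟩ := exists_spinConfig_of_le (Ls j) hj.1 hj.2
    haveI : Nonempty (Subtype (spinConfig (Λ := FermionTorus 2 (Ls j)) (a (Ls j)) (b (Ls j)))) := ⟨⟨s, hs⟩⟩
    simp_rw [hp (Ls j)]
    rw [Equiv.sum_comp (e (Ls j)) (fun c => canonicalWeight β (sectorEigenvalue (spinConfig (a (Ls j)) (b (Ls j)))
      (hubbardTorusTT' (Ls j) t t' U) (hubbardTorusTT'_isHermitian (Ls j) t t' U)) c)]
    exact sum_canonicalWeight β _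
  refine ⟨fun {ρ} hρ => ?_, fun {ρ} hρ => ?_⟩
  · have hρ' : Tendsto (fun j => (((a (Ls j) + b (Ls j) : ℕ) : ℝ) / 2 +
        (if (0 : Fin 2) = 0 then (((a (Ls j) : ℝ)) - b (Ls j)) / 2 else -((((a (Ls j) : ℝ)) - b (Ls j)) / 2))) /
          (Ls j : ℝ) ^ 2) atTop (𝓝 ρ) := by
      refine hρ.congr fun j => ?_
      rw [if_pos rfl]
      push_cast
      ring
    rw [hω.expect_nAt_eq_of_szSector' hLs hS h1 hp1 0 hρ', Complex.ofReal_re]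
  · have hρ' : Tendsto (fun j => (((a (Ls j) + b (Ls j) : ℕ) : ℝ) / 2 +
        (if (1 : Fin 2) = 0 then (((a (Ls j) : ℝ)) - b (Ls j)) / 2 else -((((a (Ls j) : ℝ)) - b (Ls j)) / 2))) /
          (Ls j : ℝ) ^ 2) atTop (𝓝 ρ) := by
      refine hρ.congr fun j => ?_
      rw [if_neg (by decide)]
      push_cast
      ring
    rw [hω.expect_nAt_eq_of_szSector' hLs hS h1 hp1 1 hρ', Complex.ofReal_re]

end InfVolFermionState

end Literature.MathematicalPhysics.QuantumLattice

end
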